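import Mathlib
import HarnessLib
import Summits.NavierStokesRegularity.NavierStokesRegularity.Theorems.TaylorModelRungThreeCertificateReadoutVSoundWinPA

/-!
# Crux K1b-DR (stmt-NavierStokesRegularity-23954), line `taylor-model` — v3 WINDOWED read-outs (POINCARÉ-CORRECTED) SOUNDNESS, part B
# (ns-tm-g4 g7): the clauses (R6), (R10w), (R11w), (W4p) and the CENTRE clauses (Wc2)–(Wc4) of `ReadoutsVP` for the interpreted records
# `toReadoutDataWinP` / `toWinDataP`

P-analogue of `…ReadoutVSoundWinB` (ns-tm-g4 g6), continuing `…ReadoutVSoundWinPA`; from `(TV.roOutWinP kitOf wT A WV j).ok = true`: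
* `readoutWP_R6` — (R6) on the FAT in-step boxes (`toReadoutDataWinP`'s `ylo/yhi` ARE part 5's `Y0/Y1`; proof = `readout_R6_gen`);
* `readoutWP_R10` — (R10w): for in-step kernels at `u` in the LEVEL-1 WINDOW, `A·(Vc + Cm·W) ∈ [Vlo, Vhi]` (the windowed kernel box `VBw`);
* `readoutWP_R11` — (R11w) on `Z¹`, given the ENTRY box of the polytope parametrisation (`readoutStepWinP_R11`);
* `readoutWP_W4` — (W4p): the windowed level-1 box `Z¹` contains the in-step states of hull-1 starts for `u ∈ [ulo 1, uhi 1]`;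
* `wv_TP_add`, `readoutWP_Zc_gen` — window values of the CENTRE polynomial's states `TP(u) + r` and their membership in the point-hull
  boxes `Zl U uR (pointBoxA x)` (`readoutStepWin_Zc`);
* `readoutWP_Wc2` / `readoutWP_Wc3` — (Wc2)/(Wc3): the centre's states at `u = ulo 0` / `u = uhi 0` have `σf < lev` / `lev < σf`
  (`Z0ca`/`Z0cb` + `readoutStepWinP_R5c`); `readoutWP_Wc4` — (Wc4): the centre's states over `[ulo 0, uhi 0]` lie in `Z⁰c`.
Part C (`…ReadoutVSoundWinPC`): the (R9p) bridge `readoutWP_R9p` and the assembly `readoutsVP_of_checks'`.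

HONEST FRAMING: kernel bookkeeping for the MODEL certificate №23954 (rung TL-M3); nothing here is a statement about the
Navier–Stokes equations.
-/

-- the sub-problem namespace repeats the summit name by design (D-0017)
set_option linter.dupNamespace false

namespace Summit.NavierStokesRegularity.NavierStokesRegularity.Theorems.TaylorModelCert

open scoped BigOperators
open Set
open Literature.Analysis.FluidPDE.TaoCascade Literature.Analysis.FluidPDE.TaoCascade.TaylorChain
open Summit.NavierStokesRegularity.NavierStokesRegularity.Theorems.TaylorModelReadout
open Summit.NavierStokesRegularity.NavierStokesRegularity.Theorems.TaylorModelV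

namespace CertTablesV

variable {TV : CertTablesV} {kitOf : ℕ → CoreKit} {wT : ℕ → Array Dyad} {sc : ScalarsV} {A : ReadoutAux QS2} {WV : WindowsV}

/-! ### (R6) on the fat in-step boxes -/

/-- **(R6)** of `ReadoutsVP` at stage `j` (the fat boxes of `toReadoutDataWin` are part 5's `Y0/Y1`). [folklore] -/
theorem readoutWP_R6 (hk : KitOK TV kitOf) {G : ℕ → ℕ → ℕ → ℝ} {ΛT : ℕ → ℝ} {j : ℕ} :
    ∀ l : Fin 2, ∀ u ∈ Icc 0 ((TV.toCertDataVW kitOf wT sc).h j ((TV.toCertDataVW kitOf wT sc).S j - 1)), ∀ Ak : Ker,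
      InStepKer (TV.toCertDataVW kitOf wT sc) (TV.toBoxesW kitOf wT) j ((TV.toCertDataVW kitOf wT sc).S j - 1) u Ak →
      ∀ y, InBox (TV.toCertDataVW kitOf wT sc) ((TV.toBoxesW kitOf wT).hlo (hullLevel l) j ((TV.toCertDataVW kitOf wT sc).S j - 1))
          ((TV.toBoxesW kitOf wT).hhi (hullLevel l) j ((TV.toCertDataVW kitOf wT sc).S j - 1)) y →
      ∀ r : Fin 4 → ℤ → ℝ, AbsLeW (TV.toCertDataVW kitOf wT sc) r
          (fun i k => (TV.toBoxesW kitOf wT).J j ((TV.toCertDataVW kitOf wT sc).S j - 1) i k * u ^ ((TV.toCertDataVW kitOf wT sc).pdeg + 1)) →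
        InBox (TV.toCertDataVW kitOf wT sc) ((TV.toReadoutDataWinP kitOf wT A WV G ΛT).ylo l j) ((TV.toReadoutDataWinP kitOf wT A WV G ΛT).yhi l j)
          ((TV.toCertDataVW kitOf wT sc).TP j ((TV.toCertDataVW kitOf wT sc).S j - 1) u + r +
            kapp (TV.toCertDataVW kitOf wT sc) Ak (y - (TV.toCertDataVW kitOf wT sc).x j ((TV.toCertDataVW kitOf wT sc).S j - 1))) := by
  intro l u hu Ak hA y hy r hr
  rcases l with ⟨_ | _ | l2, hl⟩
  · exact readout_R6_gen hk (l := 0) rfl rfl hu hA hy hr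
  · exact readout_R6_gen hk (l := 1) rfl rfl hu hA hy hr
  · omega

/-! ### (R10w) the derivative kernel over the level-1 window -/

/-- **(R10w)** of `ReadoutsVP` at stage `j`. [folklore] -/
theorem readoutWP_R10 (hk : KitOK TV kitOf) {G : ℕ → ℕ → ℕ → ℝ} {ΛT : ℕ → ℝ} {j : ℕ} (hok : (TV.roOutWinP kitOf wT A WV j).ok = true) :
    ∀ u ∈ Icc ((TV.toWinDataP kitOf wT A WV).ulo 1 j) ((TV.toWinDataP kitOf wT A WV).uhi 1 j), ∀ Ak : Ker,
      InStepKer (TV.toCertDataVW kitOf wT sc) (TV.toBoxesW kitOf wT) j ((TV.toCertDataVW kitOf wT sc).S j - 1) u Ak →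
      ∀ W : Ker, KerMem (TV.toCertDataVW kitOf wT sc) W ((TV.toRadiiW kitOf wT).Zlo j ((TV.toCertDataVW kitOf wT sc).S j - 1))
          ((TV.toRadiiW kitOf wT).Zhi j ((TV.toCertDataVW kitOf wT sc).S j - 1)) →
        KerMem (TV.toCertDataVW kitOf wT sc)
          (kerOf fun v => kapp (TV.toCertDataVW kitOf wT sc) Ak ((TV.toRadiiW kitOf wT).Vc j ((TV.toCertDataVW kitOf wT sc).S j - 1) v +
            (TV.toCertDataVW kitOf wT sc).Cm j ((TV.toCertDataVW kitOf wT sc).S j - 1) (kapp (TV.toCertDataVW kitOf wT sc) W v)))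
          ((TV.toReadoutDataWinP kitOf wT A WV G ΛT).Vlo j) ((TV.toReadoutDataWinP kitOf wT A WV G ΛT).Vhi j) := by
  intro u hu Ak hA W hW
  rw [rwP_ulo1, rwP_uhi1] at hu
  set s := (TV.base.stage j).S - 1 with hs
  have hSs : (TV.toCertDataVW kitOf wT sc).S j - 1 = s := rfl
  rw [hSs] at hA hW ⊢
  have hu0 : 0 ≤ u := (TV.base.readoutStepWinP_win (TV.roInWinP kitOf wT A WV j) hok).1.trans hu.1
  have hwm : MemMat TV.base.n (TV.base.matOfKer W) (TV.nodeVW kitOf wT j s).Z := TV.base.memMat_matOfKer cd_Kb cd_Ka hW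
  have hM := TV.base.readoutStepWin_R10 (TV.roInWin kitOf wT A WV j) hk.coef (hk.box j) (size_hullBox 2 j s) hu0 hu.1 hu.2
    (fun i k h1 h2 => mem_ωinvB j i k h1 h2) (inStep_window hA) hwm
  intro i' k' hk1' hk2' i k hk1 hk2
  have hk' : -TV.base.Kb ≤ k' ∧ k' ≤ TV.base.Ka := ⟨hk1', hk2'⟩
  have hkk : -TV.base.Kb ≤ k ∧ k ≤ TV.base.Ka := ⟨hk1, hk2⟩
  have hr := TV.base.idx_lt_n i' hk'
  have hc := TV.base.idx_lt_n i hkk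
  have hm := hM _ hr _ hc
  -- the kernel entry is the product entry
  have e : kerOf (fun v => kapp (TV.toCertDataVW kitOf wT sc) Ak ((TV.toRadiiW kitOf wT).Vc j s v +
        (TV.toCertDataVW kitOf wT sc).Cm j s (kapp (TV.toCertDataVW kitOf wT sc) W v))) i' k' i k =
      ∑ t ∈ Finset.range TV.base.n, Ak (TV.base.wi (TV.base.idx i' k')) (TV.base.wk (TV.base.idx i' k')) (TV.base.wi t) (TV.base.wk t) *
        (dre (TV.nodeVW kitOf wT j s).Vc t (TV.base.idx i k) +
          ∑ t' ∈ Finset.range TV.base.n, dre (TV.nodeVW kitOf wT j s).B t t' * TV.base.matOfKer W t' (TV.base.idx i k)) := by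
    unfold kerOf
    beta_reduce
    rw [kapp_window Ak _ i' hk', TV.base.wi_idx i' hk', TV.base.wk_idx i' hk']
    refine Finset.sum_congr rfl fun t ht => ?_
    have ht' := Finset.mem_range.1 ht
    congr 1
    rw [rd_Vc, cd_Cm, TV.base.wv_add, TV.base.wv_linF _ _ ht', TV.base.wv_linF _ _ ht']
    congr 1
    · rw [Finset.sum_congr rfl (fun c hc' => by rw [wv_basisSt i hkk (Finset.mem_range.1 hc')])]
      simp only [mul_ite, mul_one, mul_zero]
      rw [Finset.sum_ite_eq' (Finset.range TV.base.n) (TV.base.idx i k), if_pos (Finset.mem_range.2 hc)]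
    · refine Finset.sum_congr rfl fun t' ht'' => ?_
      congr 1
      rw [wv_kapp W _ (Finset.mem_range.1 ht'')]
      unfold CertTables.matOfKer
      rw [Finset.sum_congr rfl (fun c hc' => by rw [wv_basisSt i hkk (Finset.mem_range.1 hc')])]
      simp only [mul_ite, mul_one, mul_zero]
      rw [Finset.sum_ite_eq' (Finset.range TV.base.n) (TV.base.idx i k), if_pos (Finset.mem_range.2 hc),
        TV.base.wi_idx i hkk, TV.base.wk_idx i hkk]
  rw [e, rowP_Vlo, rowP_Vhi]
  exact hm

/-! ### (R11w) landing derivative on the level-1 window box -/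

/-- **(R11w)** of `ReadoutsVP` at stage `j`, given the ENTRY box of the polytope parametrisation. [folklore] -/
theorem readoutWP_R11 (hk : KitOK TV kitOf) (hA : TV.base.checkReadoutAux A = true) {G : ℕ → ℕ → ℕ → ℝ} {ΛT : ℕ → ℝ} {j : ℕ}
    (hok : (TV.roOutWinP kitOf wT A WV j).ok = true)
    (hentry : ∀ q ζ : Fin 4 → ℤ → ℝ, InPoly (TV.toCertDataVW kitOf wT sc) j q →
      (∀ i k, -(TV.toCertDataVW kitOf wT sc).Kb ≤ k → k ≤ (TV.toCertDataVW kitOf wT sc).Ka →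
        q i k = ((TV.toCertDataVW kitOf wT sc).x j 0 + (TV.toRadiiW kitOf wT).Dsc j ζ) i k) →
      ∀ c < TV.base.n, |TV.base.wv ζ c| ≤ (dget (TV.stageV j).rB c).toReal) :
    ∀ y, InBox (TV.toCertDataVW kitOf wT sc) ((TV.toWinDataP kitOf wT A WV).zlo 1 j) ((TV.toWinDataP kitOf wT A WV).zhi 1 j) y →
      (TV.toCertDataVW kitOf wT sc).σf j y = (TV.toCertDataVW kitOf wT sc).lev j →
      ∀ V : Ker, KerMem (TV.toCertDataVW kitOf wT sc) V ((TV.toReadoutDataWinP kitOf wT A WV G ΛT).Vlo j) ((TV.toReadoutDataWinP kitOf wT A WV G ΛT).Vhi j) →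
      ∀ q ζ : Fin 4 → ℤ → ℝ, InPoly (TV.toCertDataVW kitOf wT sc) j q →
        (∀ i k, -(TV.toCertDataVW kitOf wT sc).Kb ≤ k → k ≤ (TV.toCertDataVW kitOf wT sc).Ka →
          q i k = ((TV.toCertDataVW kitOf wT sc).x j 0 + (TV.toRadiiW kitOf wT).Dsc j ζ) i k) →
      ∀ v, TailOK (TV.toCertDataVW kitOf wT sc) v → ∀ l,
        |(TV.toCertDataVW kitOf wT sc).ℓ ((TV.toCertDataVW kitOf wT sc).nx j) l
          ((TV.toCertDataVW kitOf wT sc).landD j y v (secCorr (TV.toCertDataVW kitOf wT sc) j y (kapp (TV.toCertDataVW kitOf wT sc) V ζ)))|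
          ≤ (TV.toCertDataVW kitOf wT sc).β j l := by
  intro y hy _ V hV q ζ hq hwin v hv l
  rw [rwP_zlo1, rwP_zhi1] at hy
  rw [rowP_Vlo, rowP_Vhi] at hV
  rw [cd_nx, cd_ell, cd_landD, cd_secCorr, cd_beta]
  by_cases hl : l < TV.nF j
  · rw [TV.base.covR_apply]
    exact TV.base.readoutStepWinP_R11 (TV.roInWinP kitOf wT A WV j) hk.coef (hk.box j) (hk.mt j) hok (mem_faceB _ _) (mem_partnerG j _)
      (mem_partnerR j _) (mem_listB _ _) (IntervalD.mem_ofQS2 _ _) (tail_le (kitOf := kitOf) (wT := wT) (sc := sc) hA hv)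
      (memVec_of_inBox_loR hy) (mem_covB _) (TV.base.memMat_matOfKer cd_Kb cd_Ka hV) (hentry q ζ hq hwin)
      (fun l' _ => partner_face hq hwin l') (fun b hb => wv_kapp V ζ hb) hl
  · rw [not_lt] at hl
    obtain ⟨h1, h2, _, _, _⟩ := lengths_le_nF (TV := TV) j
    rw [List.getD_eq_default _ _ (le_trans h1 hl), TV.base.covR_nil, vget_of_le _ (le_trans h2 hl)]
    simp

/-! ### (W4p) the windowed level-1 in-step box -/

/-- **(W4p)** of `ReadoutsVP` at stage `j`: for `u` in the LEVEL-1 window, the in-step states of hull-1 starts lie in `Z¹`. [folklore] -/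
theorem readoutWP_W4 (hk : KitOK TV kitOf) {j : ℕ} (hok : (TV.roOutWinP kitOf wT A WV j).ok = true) :
    ∀ u ∈ Icc ((TV.toWinDataP kitOf wT A WV).ulo 1 j) ((TV.toWinDataP kitOf wT A WV).uhi 1 j), ∀ Ak : Ker,
      InStepKer (TV.toCertDataVW kitOf wT sc) (TV.toBoxesW kitOf wT) j ((TV.toCertDataVW kitOf wT sc).S j - 1) u Ak →
      ∀ y, InBox (TV.toCertDataVW kitOf wT sc) ((TV.toBoxesW kitOf wT).hlo 1 j ((TV.toCertDataVW kitOf wT sc).S j - 1))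
          ((TV.toBoxesW kitOf wT).hhi 1 j ((TV.toCertDataVW kitOf wT sc).S j - 1)) y →
      ∀ r : Fin 4 → ℤ → ℝ, AbsLeW (TV.toCertDataVW kitOf wT sc) r
          (fun i k => (TV.toBoxesW kitOf wT).J j ((TV.toCertDataVW kitOf wT sc).S j - 1) i k * u ^ ((TV.toCertDataVW kitOf wT sc).pdeg + 1)) →
        InBox (TV.toCertDataVW kitOf wT sc) ((TV.toWinDataP kitOf wT A WV).zlo 1 j) ((TV.toWinDataP kitOf wT A WV).zhi 1 j)
          ((TV.toCertDataVW kitOf wT sc).TP j ((TV.toCertDataVW kitOf wT sc).S j - 1) u + r +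
            kapp (TV.toCertDataVW kitOf wT sc) Ak (y - (TV.toCertDataVW kitOf wT sc).x j ((TV.toCertDataVW kitOf wT sc).S j - 1))) := by
  intro u hu Ak hA y hy r hr
  exact inBox_loR_of_memVec (readoutWP_Zl_gen (sc := sc) hk hok (l := 1) rfl (U := ⟨(winAt WV j).u1lo, (winAt WV j).u1hi⟩)
    (uR := (winAt WV j).u1hi) ⟨hu.1, hu.2⟩ hu.1 hu.2 hu.2 hA hy hr)

/-! ### The centre polynomial's states: (Wc2)–(Wc4) -/

/-- Window values of the centre polynomial's state `TP(u) + r`. [folklore] -/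
theorem wv_TP_add (j s : ℕ) (u : ℝ) (r : Fin 4 → ℤ → ℝ) (c : ℕ) :
    TV.base.wv ((TV.toCertDataVW kitOf wT sc).TP j s u + r) c =
      (∑ n ∈ Finset.range (TV.base.pdeg + 1), taylorJet (TV.base.toCertData QS2.toRealHom).Qb (TV.base.vecF (vre (TV.xD j s))) n
          (TV.base.wi c) (TV.base.wk c) * u ^ n) + TV.base.wv r c := by
  rw [TV.base.wv_add]
  rfl

/-- **The centre's in-step states in the point-hull boxes, generic**: for `u ∈ U`, `0 ≤ u ≤ uR` and a remainder `r` with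
`|r| ≤ J·u^(p+1)` on the window, the window values of `TP(u) + r` lie in `Zl U uR (pointBoxA x)`. [folklore] -/
theorem readoutWP_Zc_gen (hk : KitOK TV kitOf) (j : ℕ) {U : IntervalD} {uR : Dyad} {u : ℝ} (huU : IntervalD.mem u U) (hu0 : 0 ≤ u)
    (huR : u ≤ uR.toReal) {r : Fin 4 → ℤ → ℝ} (hr : AbsLeW (TV.toCertDataVW kitOf wT sc) r
      (fun i k => (TV.toBoxesW kitOf wT).J j ((TV.toCertDataVW kitOf wT sc).S j - 1) i k * u ^ ((TV.toCertDataVW kitOf wT sc).pdeg + 1))) :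
    MemVec TV.base.n (TV.base.wv ((TV.toCertDataVW kitOf wT sc).TP j ((TV.toCertDataVW kitOf wT sc).S j - 1) u + r))
      ((TV.roInWin kitOf wT A WV j).Zl TV.base U uR (IntervalD.pointBoxA TV.base.n (TV.roIn kitOf wT A j).x)) := by
  set s := (TV.base.stage j).S - 1 with hs
  have hSs : (TV.toCertDataVW kitOf wT sc).S j - 1 = s := rfl
  rw [hSs] at hr ⊢
  have hF := TV.base.readoutStepWin_Zc (TV.roInWin kitOf wT A WV j) hk.coef (hk.box j) (hk.mt j) huU hu0 huR
    (r := r) (fun c hc => by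
      have hkc := TV.base.InW_wk hc
      have h1 := hr (TV.base.wi c) (TV.base.wk c) hkc.1 hkc.2
      dsimp only at h1
      rw [bx_J, TV.base.vecF_apply, if_pos hkc, TV.base.idx_wi_wk hc] at h1
      exact h1)
  intro c hc
  rw [wv_TP_add]
  exact hF c hc

/-- **(Wc2)** of `ReadoutsVP` at stage `j`: the centre's states at `u = ulo 0` have `σf < lev` (`Z0ca` + the centre window-end test).
[folklore] -/
theorem readoutWP_Wc2 (hk : KitOK TV kitOf) {j : ℕ} (hok : (TV.roOutWinP kitOf wT A WV j).ok = true) :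
    ∀ r : Fin 4 → ℤ → ℝ, AbsLeW (TV.toCertDataVW kitOf wT sc) r
        (fun i k => (TV.toBoxesW kitOf wT).J j ((TV.toCertDataVW kitOf wT sc).S j - 1) i k *
          (TV.toWinDataP kitOf wT A WV).ulo 0 j ^ ((TV.toCertDataVW kitOf wT sc).pdeg + 1)) →
      (TV.toCertDataVW kitOf wT sc).σf j ((TV.toCertDataVW kitOf wT sc).TP j ((TV.toCertDataVW kitOf wT sc).S j - 1)
          ((TV.toWinDataP kitOf wT A WV).ulo 0 j) + r) < (TV.toCertDataVW kitOf wT sc).lev j := by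
  have hw := TV.base.readoutStepWinP_win (TV.roInWinP kitOf wT A WV j) hok
  intro r hr
  rw [cd_sigma, cd_lev]
  have hm := readoutWP_Zc_gen (sc := sc) (A := A) (WV := WV) hk j (U := ⟨(winAt WV j).u0lo, (winAt WV j).u0lo⟩) (uR := (winAt WV j).u0lo)
    ⟨le_rfl, le_rfl⟩ (hw.1.trans hw.2.1) le_rfl hr
  exact (TV.base.readoutStepWinP_R5c (TV.roInWinP kitOf wT A WV j) hok (mem_covB (TV.base.stage j).σf)
    (IntervalD.mem_ofQS2 TV.prec (TV.base.stage j).lev)).1 _ hm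

/-- **(Wc3)** of `ReadoutsVP` at stage `j`: the centre's states at `u = uhi 0` have `lev < σf` (`Z0cb`). [folklore] -/
theorem readoutWP_Wc3 (hk : KitOK TV kitOf) {j : ℕ} (hok : (TV.roOutWinP kitOf wT A WV j).ok = true) :
    ∀ r : Fin 4 → ℤ → ℝ, AbsLeW (TV.toCertDataVW kitOf wT sc) r
        (fun i k => (TV.toBoxesW kitOf wT).J j ((TV.toCertDataVW kitOf wT sc).S j - 1) i k *
          (TV.toWinDataP kitOf wT A WV).uhi 0 j ^ ((TV.toCertDataVW kitOf wT sc).pdeg + 1)) →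
      (TV.toCertDataVW kitOf wT sc).lev j < (TV.toCertDataVW kitOf wT sc).σf j ((TV.toCertDataVW kitOf wT sc).TP j
          ((TV.toCertDataVW kitOf wT sc).S j - 1) ((TV.toWinDataP kitOf wT A WV).uhi 0 j) + r) := by
  have hw := TV.base.readoutStepWinP_win (TV.roInWinP kitOf wT A WV j) hok
  intro r hr
  rw [cd_sigma, cd_lev]
  have hm := readoutWP_Zc_gen (sc := sc) (A := A) (WV := WV) hk j (U := ⟨(winAt WV j).u0hi, (winAt WV j).u0hi⟩) (uR := (winAt WV j).u0hi)
    ⟨le_rfl, le_rfl⟩ (hw.1.trans (hw.2.1.trans hw.2.2.1)) le_rfl hr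
  exact (TV.base.readoutStepWinP_R5c (TV.roInWinP kitOf wT A WV j) hok (mem_covB (TV.base.stage j).σf)
    (IntervalD.mem_ofQS2 TV.prec (TV.base.stage j).lev)).2 _ hm

/-- **(Wc4)** of `ReadoutsVP` at stage `j`: the centre's states over the centre window lie in the centre-only box `Z⁰c`. [folklore] -/
theorem readoutWP_Wc4 (hk : KitOK TV kitOf) {j : ℕ} (hok : (TV.roOutWinP kitOf wT A WV j).ok = true) :
    ∀ u ∈ Icc ((TV.toWinDataP kitOf wT A WV).ulo 0 j) ((TV.toWinDataP kitOf wT A WV).uhi 0 j), ∀ r : Fin 4 → ℤ → ℝ,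
      AbsLeW (TV.toCertDataVW kitOf wT sc) r
        (fun i k => (TV.toBoxesW kitOf wT).J j ((TV.toCertDataVW kitOf wT sc).S j - 1) i k * u ^ ((TV.toCertDataVW kitOf wT sc).pdeg + 1)) →
        InBox (TV.toCertDataVW kitOf wT sc) ((TV.toWinDataP kitOf wT A WV).zlo 0 j) ((TV.toWinDataP kitOf wT A WV).zhi 0 j)
          ((TV.toCertDataVW kitOf wT sc).TP j ((TV.toCertDataVW kitOf wT sc).S j - 1) u + r) := by
  have hw := TV.base.readoutStepWinP_win (TV.roInWinP kitOf wT A WV j) hok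
  intro u hu r hr
  exact inBox_loR_of_memVec (readoutWP_Zc_gen (sc := sc) (A := A) (WV := WV) hk j (U := ⟨(winAt WV j).u0lo, (winAt WV j).u0hi⟩)
    (uR := (winAt WV j).u0hi) ⟨hu.1, hu.2⟩ ((hw.1.trans hw.2.1).trans hu.1) hu.2 hr)

end CertTablesV

end Summit.NavierStokesRegularity.NavierStokesRegularity.Theorems.TaylorModelCert
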